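import Mathlib.Geometry.Manifold.IntegralCurve.Basic
import Mathlib.Geometry.Manifold.VectorField.Pullback
import Mathlib.Analysis.ODE.Gronwall
import Mathlib.Analysis.Calculus.ContDiff.RCLike
import Mathlib.Analysis.Calculus.LineDeriv.Basic
import Mathlib.LinearAlgebra.Projection
import HarnessLib

/-!
# Integral curves of a vector field tangent to a straightened closed set stay in it

General differential topology, serving the relative form of Ehresmann's fibration theorem
(Dimca 1992, Ch. 1, Prop. (3.1), second part: for a proper submersion `f : E → B` and a closed
submanifold `A ⊂ E` with `f|A` a submersion, "the diffeomorphism `φ` above can be chosen to carry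
`(f⁻¹(b) ∩ A) × U` onto `f⁻¹(U) ∩ A`"; and its version for several submanifolds crossing
normally, the simplest case of Thom's first isotopy lemma, Dimca 1992 Ch. 1 Thm. (3.5)). The
trivialisations of Ehresmann's theorem are composites of flows of lifted coordinate fields
(Bröcker–Jänich 1982, (8.12); the tree's `Literature.Geometry.Manifold.ProperSubmersionTrivial`);
they respect `A` as soon as the lifted fields are tangent to `A`, because **an integral curve of a
`C¹` vector field tangent to a closed subset which is straightened by adapted charts cannot leave
or enter that subset** — the statement of this file:

* `mem_submodule_of_hasDerivAt_of_lipschitzOnWith` — the chart-level estimate: a solution of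
  `c' = W(c)` with `W` Lipschitz and `W(z) ∈ L` for `z ∈ L` (`L` a linear subspace), starting on
  `L`, stays on `L` (Grönwall: the component of `c` transverse to `L` satisfies
  `‖p'‖ ≤ C ‖p‖`, `p(a) = 0`);
* `fderiv_symm_trans_mem_of_straightened` — tangency does not depend on the adapted chart: if two
  charts straighten the same closed set `D` near a point of `D` onto linear subspaces `L`, `L'`,
  the differential of the transition map carries `L` into `L'`;
* `mem_iff_mem_of_isMIntegralCurve_of_tangent` — **invariance**: on a `C^∞` manifold, for a `C¹`
  vector field `V` and a closed set `D` such that every point of `D` has a `C^∞` chart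
  `φ` (an open partial homeomorphism onto an open subset of a normed space, `C^∞` with `C^∞`
  inverse) with `D ∩ source φ = φ⁻¹(L)` for a linear subspace `L` and `dφ(V y) ∈ L` for
  `y ∈ D ∩ source φ`, an integral curve `γ` of `V` defined on `ℝ` lies in `D` at one time iff it
  lies in `D` at all times.

Everything is proved; no definitions.

## References

* A. Dimca, *Singularities and Topology of Hypersurfaces*, Universitext, Springer 1992, Ch. 1,
  Prop. (3.1) and Thm. (3.5) (held: `lit read book:dimca1992-singularities-topology-hypersurfaces`,
  PDF p. 28). [Dimca1992]
* Th. Bröcker, K. Jänich, *Introduction to Differential Topology*, CUP 1982, (8.12).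
  [BrockerJanichIDT1982]
-/

open scoped Manifold ContDiff Topology NNReal
open Set Function Filter Metric

noncomputable section

namespace Literature.Geometry.Manifold

universe u v

/-! ### Linear algebra: a continuous projection with prescribed kernel -/

section Projection

variable {F : Type u} [NormedAddCommGroup F] [NormedSpace ℝ F] [FiniteDimensional ℝ F]

/-- In a finite-dimensional space every linear subspace `L` is the kernel of a continuous linear
endomorphism `P` with `z - P z ∈ L` for all `z` (the projection onto a complement of `L` along
`L`). [folklore] -/
theorem exists_continuousLinearMap_ker_eq (L : Submodule ℝ F) :
    ∃ P : F →L[ℝ] F, (∀ z, P z = 0 ↔ z ∈ L) ∧ ∀ z, z - P z ∈ L := by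
  obtain ⟨Lc, hc⟩ := L.exists_isCompl
  have hc' : IsCompl Lc L := hc.symm
  refine ⟨LinearMap.toContinuousLinearMap (Lc.projection L hc'), fun z => ?_, fun z => ?_⟩
  · exact Submodule.projection_apply_eq_zero_iff hc'
  · change z - Lc.projection L hc' z ∈ L
    rw [← Submodule.projection_eq_self_sub_projection hc' z]
    exact Submodule.projection_apply_mem _ _

end Projection

/-! ### The chart-level estimate (Grönwall) -/

section Gronwall

variable {F : Type u} [NormedAddCommGroup F] [NormedSpace ℝ F]

/-- **A solution of an autonomous ODE with Lipschitz right-hand side tangent to a linear subspace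
`L` stays in `L`** (forward in time). Let `W` be `K`-Lipschitz on `B`, with `W z ∈ L` for
`z ∈ B ∩ L`; let `P` be a continuous linear map with kernel `L` and `z - P z ∈ L`. If `c` solves
`c' = W (c)` on `[a, b]`, with `c t` and `c t - P (c t)` in `B`, and `c a ∈ L`, then `c t ∈ L`
for `t ∈ [a, b]`: the transverse component `p = P ∘ c` satisfies `‖p'‖ ≤ ‖P‖ K ‖p‖`, `p a = 0`,
so `p = 0` by Grönwall's inequality. [folklore] -/
theorem mem_submodule_of_hasDerivAt_of_lipschitzOnWith {L : Submodule ℝ F} {W : F → F}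
    {B : Set F} {K : ℝ≥0} (hW : LipschitzOnWith K W B) (htan : ∀ z ∈ B, z ∈ L → W z ∈ L)
    {P : F →L[ℝ] F} (hP : ∀ z, P z = 0 ↔ z ∈ L) (hP' : ∀ z, z - P z ∈ L)
    {c : ℝ → F} {a b : ℝ} (hc : ∀ t ∈ Icc a b, HasDerivAt c (W (c t)) t)
    (hcB : ∀ t ∈ Icc a b, c t ∈ B) (hcB' : ∀ t ∈ Icc a b, c t - P (c t) ∈ B) (ha : c a ∈ L) :
    ∀ t ∈ Icc a b, c t ∈ L := by
  set p : ℝ → F := fun t => P (c t) with hp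
  have hpc : ContinuousOn p (Icc a b) := fun t ht =>
    (P.continuous.continuousAt.comp (hc t ht).continuousAt).continuousWithinAt
  have hp' : ∀ t ∈ Ico a b, HasDerivWithinAt p (P (W (c t))) (Ici t) t := fun t ht =>
    (P.hasFDerivAt.comp_hasDerivAt t (hc t (Ico_subset_Icc_self ht))).hasDerivWithinAt
  have hpa : ‖p a‖ ≤ 0 := by
    have : P (c a) = 0 := (hP _).2 ha
    simp [hp, this]
  have hbound : ∀ t ∈ Ico a b, ‖P (W (c t))‖ ≤ ‖P‖ * K * ‖p t‖ + 0 := by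
    intro t ht
    have ht' : t ∈ Icc a b := Ico_subset_Icc_self ht
    -- `W (c t - P (c t)) ∈ L`, so it is killed by `P`
    have hz' : W (c t - P (c t)) ∈ L := htan _ (hcB' t ht') (hP' _)
    have hPz' : P (W (c t - P (c t))) = 0 := (hP _).2 hz'
    have heq : P (W (c t)) = P (W (c t) - W (c t - P (c t))) := by
      rw [map_sub, hPz', sub_zero]
    rw [heq, add_zero]
    calc ‖P (W (c t) - W (c t - P (c t)))‖
        ≤ ‖P‖ * ‖W (c t) - W (c t - P (c t))‖ := P.le_opNorm _
      _ ≤ ‖P‖ * (K * ‖c t - (c t - P (c t))‖) := by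
          gcongr
          rw [← dist_eq_norm, ← dist_eq_norm]
          exact hW.dist_le_mul (c t) (hcB t ht') (c t - P (c t)) (hcB' t ht')
      _ = ‖P‖ * K * ‖p t‖ := by
          rw [sub_sub_cancel, mul_assoc]
  intro t ht
  have h := norm_le_gronwallBound_of_norm_deriv_right_le hpc hp' hpa hbound t ht
  rw [gronwallBound_ε0_δ0] at h
  have h0 : p t = 0 := norm_le_zero_iff.1 h
  exact (hP _).1 h0

/-- The same, backward in time: if `c` solves `c' = W (c)` on `[a, b]` under the hypotheses of
`mem_submodule_of_hasDerivAt_of_lipschitzOnWith` and `c b ∈ L`, then `c t ∈ L` on `[a, b]`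
(apply the forward statement to `s ↦ c (-s)` and `-W`). [folklore] -/
theorem mem_submodule_of_hasDerivAt_of_lipschitzOnWith_of_right {L : Submodule ℝ F} {W : F → F}
    {B : Set F} {K : ℝ≥0} (hW : LipschitzOnWith K W B) (htan : ∀ z ∈ B, z ∈ L → W z ∈ L)
    {P : F →L[ℝ] F} (hP : ∀ z, P z = 0 ↔ z ∈ L) (hP' : ∀ z, z - P z ∈ L)
    {c : ℝ → F} {a b : ℝ} (hc : ∀ t ∈ Icc a b, HasDerivAt c (W (c t)) t)
    (hcB : ∀ t ∈ Icc a b, c t ∈ B) (hcB' : ∀ t ∈ Icc a b, c t - P (c t) ∈ B) (hb : c b ∈ L) :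
    ∀ t ∈ Icc a b, c t ∈ L := by
  intro t ht
  have hW' : LipschitzOnWith K (fun z => -W z) B := fun x hx y hy => by
    rw [edist_neg_neg]
    exact hW hx hy
  have htan' : ∀ z ∈ B, z ∈ L → -W z ∈ L := fun z hz hzL => L.neg_mem (htan z hz hzL)
  have hc' : ∀ s ∈ Icc (-b) (-a), HasDerivAt (fun s => c (-s)) (-W (c (-s))) s := by
    intro s hs
    have hs' : -s ∈ Icc a b := ⟨by linarith [hs.2], by linarith [hs.1]⟩
    have h1 := (hc (-s) hs').scomp s (hasDerivAt_neg s)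
    simpa [Function.comp_def] using h1
  have key := mem_submodule_of_hasDerivAt_of_lipschitzOnWith (L := L) hW' htan' hP hP' hc'
    (fun s hs => hcB (-s) ⟨by linarith [hs.2], by linarith [hs.1]⟩)
    (fun s hs => hcB' (-s) ⟨by linarith [hs.2], by linarith [hs.1]⟩) (by simpa using hb)
    (-t) ⟨by linarith [ht.2], by linarith [ht.1]⟩
  simpa using key

end Gronwall

/-! ### Charts straightening a closed set: the differential of the chart read as an equivalence -/

section Manifold

variable {E : Type u} [NormedAddCommGroup E] [NormedSpace ℝ E]
  {H : Type*} [TopologicalSpace H] {I : ModelWithCorners ℝ E H}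
  {M : Type*} [TopologicalSpace M] [ChartedSpace H M]
  {F : Type v} [NormedAddCommGroup F] [NormedSpace ℝ F]

/-- For an open partial homeomorphism `φ : M ⇀ F` which is `C¹` with `C¹` inverse, the differential
of `φ.symm` at a point of the target is invertible, with inverse the differential of `φ`.
[folklore] -/
theorem inverse_mfderiv_symm_eq {φ : OpenPartialHomeomorph M F} {n : WithTop ℕ∞} (hn : n ≠ 0)
    (hφ : ContMDiffOn I 𝓘(ℝ, F) n φ φ.source) (hφs : ContMDiffOn 𝓘(ℝ, F) I n φ.symm φ.target)
    {z : F} (hz : z ∈ φ.target) :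
    (mfderiv 𝓘(ℝ, F) I φ.symm z).IsInvertible ∧
      (mfderiv 𝓘(ℝ, F) I φ.symm z).inverse = mfderiv I 𝓘(ℝ, F) φ (φ.symm z) := by
  have he : φ.MDifferentiable I 𝓘(ℝ, F) := ⟨hφ.mdifferentiableOn hn, hφs.mdifferentiableOn hn⟩
  let e := he.symm.mfderiv (x := z) hz
  have hcoe : (e : TangentSpace 𝓘(ℝ, F) z →L[ℝ] TangentSpace I (φ.symm z)) =
      mfderiv 𝓘(ℝ, F) I φ.symm z := rfl
  refine ⟨⟨e, hcoe⟩, ?_⟩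
  rw [← hcoe, ContinuousLinearMap.inverse_equiv]
  rfl

/-- For `φ` as above, the differential of `φ` at a point of the source is invertible. [folklore] -/
theorem isInvertible_mfderiv_of_contMDiffOn_symm {φ : OpenPartialHomeomorph M F} {n : WithTop ℕ∞}
    (hn : n ≠ 0) (hφ : ContMDiffOn I 𝓘(ℝ, F) n φ φ.source)
    (hφs : ContMDiffOn 𝓘(ℝ, F) I n φ.symm φ.target) {x : M} (hx : x ∈ φ.source) :
    (mfderiv I 𝓘(ℝ, F) φ x).IsInvertible := by
  have he : φ.MDifferentiable I 𝓘(ℝ, F) := ⟨hφ.mdifferentiableOn hn, hφs.mdifferentiableOn hn⟩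
  exact ⟨he.mfderiv hx, rfl⟩

/-! ### Tangency to a straightened closed set does not depend on the chart -/

/-- **Transition maps of charts straightening the same closed set preserve the straightening
subspaces infinitesimally.** Let `φ, φ' : M ⇀ F` be open partial homeomorphisms, `φ` being `C¹`
with `C¹` inverse and `φ'` being `C¹`, which straighten a closed set `D` on their sources:
`D ∩ source φ = φ⁻¹(L)`, `D ∩ source φ' = φ'⁻¹(L')` for linear subspaces `L`, `L'` (`F`
finite-dimensional). Then at a point `y ∈ D` of both sources, a tangent vector `v` with
`dφ(v) ∈ L` has `dφ'(v) ∈ L'`: indeed `dφ'(v) = d(φ' ∘ φ⁻¹)(dφ(v))`, and the transition map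
`φ' ∘ φ⁻¹` sends `L` into `L'` near `φ y`, so its differential sends `L` into the closed subspace
`L'` (limit of difference quotients along `L`). [folklore] -/
theorem mfderiv_mem_of_straightened [FiniteDimensional ℝ F] {φ φ' : OpenPartialHomeomorph M F}
    (hφ : ContMDiffOn I 𝓘(ℝ, F) 1 φ φ.source) (hφs : ContMDiffOn 𝓘(ℝ, F) I 1 φ.symm φ.target)
    (hφ' : ContMDiffOn I 𝓘(ℝ, F) 1 φ' φ'.source) {D : Set M} {L L' : Submodule ℝ F}
    (hL : D ∩ φ.source = φ.source ∩ φ ⁻¹' (L : Set F))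
    (hL' : D ∩ φ'.source = φ'.source ∩ φ' ⁻¹' (L' : Set F)) {y : M} (hy : y ∈ D)
    (hyφ : y ∈ φ.source) (hyφ' : y ∈ φ'.source) {v : TangentSpace I y}
    (hv : mfderiv I 𝓘(ℝ, F) φ y v ∈ L) : mfderiv I 𝓘(ℝ, F) φ' y v ∈ L' := by
  haveI : CompleteSpace F := FiniteDimensional.complete ℝ F
  set z : F := φ y with hz
  have hzt : z ∈ φ.target := φ.map_source hyφ
  -- the transition map and its domain
  set τ : F → F := φ' ∘ φ.symm with hτ
  set O : Set F := φ.target ∩ φ.symm ⁻¹' φ'.source with hO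
  have hOo : IsOpen O := φ.isOpen_inter_preimage_symm φ'.open_source
  have hzO : z ∈ O := ⟨hzt, by rw [mem_preimage, hz, φ.left_inv hyφ]; exact hyφ'⟩
  have hτs : ContMDiffOn 𝓘(ℝ, F) 𝓘(ℝ, F) 1 τ O :=
    hφ'.comp (hφs.mono inter_subset_left) fun w hw => hw.2
  have hτd : HasFDerivAt τ (fderiv ℝ τ z) z := by
    have h1 : ContDiffOn ℝ 1 τ O := contMDiffOn_iff_contDiffOn.1 hτs
    exact ((h1.differentiableOn one_ne_zero) z hzO).differentiableAt (hOo.mem_nhds hzO) |>.hasFDerivAt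
  -- `τ` maps `O ∩ L` into `L'`
  have hτL : ∀ w ∈ O, w ∈ L → τ w ∈ L' := by
    intro w hw hwL
    have h1 : φ.symm w ∈ D ∩ φ.source := by
      rw [hL]
      exact ⟨φ.map_target hw.1, by rw [mem_preimage, φ.right_inv hw.1]; exact hwL⟩
    have h2 : φ.symm w ∈ D ∩ φ'.source := ⟨h1.1, hw.2⟩
    rw [hL'] at h2
    exact h2.2
  have hzL : z ∈ L := by
    have h1 : y ∈ D ∩ φ.source := ⟨hy, hyφ⟩
    rw [hL] at h1
    exact h1.2
  -- the differential of `τ` at `z` maps `L` into `L'`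
  have hdτ : ∀ ℓ ∈ L, fderiv ℝ τ z ℓ ∈ L' := by
    intro ℓ hℓ
    have hline : HasLineDerivAt ℝ τ (fderiv ℝ τ z ℓ) z ℓ := hτd.hasLineDerivAt ℓ
    rw [HasLineDerivAt, hasDerivAt_iff_tendsto_slope] at hline
    refine L'.closed_of_finiteDimensional.mem_of_tendsto hline ?_
    -- eventually the difference quotients lie in `L'`
    have hev : ∀ᶠ t : ℝ in 𝓝 0, z + t • ℓ ∈ O := by
      have hc : Continuous fun t : ℝ => z + t • ℓ := by fun_prop
      have : (fun t : ℝ => z + t • ℓ) ⁻¹' O ∈ 𝓝 (0 : ℝ) :=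
        hc.continuousAt.preimage_mem_nhds (by simpa using hOo.mem_nhds hzO)
      exact this
    have hev' : ∀ᶠ t : ℝ in 𝓝[≠] 0, z + t • ℓ ∈ O := nhdsWithin_le_nhds hev
    filter_upwards [hev'] with t ht
    have hmem : τ (z + t • ℓ) - τ (z + (0 : ℝ) • ℓ) ∈ L' := by
      rw [zero_smul, add_zero]
      exact L'.sub_mem (hτL _ ht (L.add_mem hzL (L.smul_mem t hℓ))) (hτL _ hzO hzL)
    exact L'.smul_mem _ hmem
  -- chain rule: `dφ'(v) = dτ(dφ(v))`
  have h1 : HasMFDerivAt I 𝓘(ℝ, F) φ y (mfderiv I 𝓘(ℝ, F) φ y) :=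
    ((hφ.mdifferentiableOn one_ne_zero y hyφ).mdifferentiableAt
      (φ.open_source.mem_nhds hyφ)).hasMFDerivAt
  have h2 : HasMFDerivAt 𝓘(ℝ, F) 𝓘(ℝ, F) τ (φ y) (fderiv ℝ τ z) :=
    hasMFDerivAt_iff_hasFDerivAt.2 hτd
  have h3 : HasMFDerivAt I 𝓘(ℝ, F) (τ ∘ φ) y ((fderiv ℝ τ z).comp (mfderiv I 𝓘(ℝ, F) φ y)) :=
    h2.comp y h1
  have heq : τ ∘ φ =ᶠ[𝓝 y] φ' := by
    have : φ.source ∩ φ ⁻¹' O ∈ 𝓝 y :=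
      (φ.isOpen_inter_preimage hOo).mem_nhds ⟨hyφ, hzO⟩
    filter_upwards [this] with w hw
    show φ' (φ.symm (φ w)) = φ' w
    rw [φ.left_inv hw.1]
  have h4 : mfderiv I 𝓘(ℝ, F) φ' y = (fderiv ℝ τ z).comp (mfderiv I 𝓘(ℝ, F) φ y) :=
    (h3.congr_of_eventuallyEq heq.symm).mfderiv
  rw [h4]
  exact hdτ _ hv

/-! ### Invariance of straightened closed sets under integral curves of tangent fields -/

-- the tangent spaces of the model vector space `F` are `F` by definition, which the calculus
-- lemmas must see through
set_option backward.isDefEq.respectTransparency false in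
/-- **An integral curve of a `C¹` field tangent to a straightened closed set which starts in the
set stays in it, locally in time.** Let `V` be a `C¹` vector field on the `C^∞` manifold `M`
(complete model), `D ⊆ M`, and `φ : M ⇀ F` an open partial homeomorphism (`F` finite-dimensional),
`C^∞` with `C^∞` inverse, with `D ∩ source φ = φ⁻¹(L)` for a linear subspace `L` and
`dφ(V y) ∈ L` for all `y ∈ D ∩ source φ`. If `γ` is an integral curve of `V` on `ℝ` with
`γ t₁ ∈ D ∩ source φ`, then `γ t ∈ D` for all `t` near `t₁`. Proof: `c = φ ∘ γ` solves `c' = W(c)`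
for the field `W = φ_* V` read in the chart, which is `C¹`, hence Lipschitz near `φ (γ t₁)`, and
tangent to `L` along `L`; conclude by `mem_submodule_of_hasDerivAt_of_lipschitzOnWith`.
[cite: Dimca1992, Ch. 1 Prop. (3.1) (proof: the trivialising flows preserve `A`)] -/
theorem eventually_mem_of_isMIntegralCurve_of_tangent [CompleteSpace E] [IsManifold I ∞ M]
    [FiniteDimensional ℝ F] {V : Π x : M, TangentSpace I x}
    (hV : ContMDiff I I.tangent 1 (fun x => (⟨x, V x⟩ : TangentBundle I M)))
    {D : Set M} {φ : OpenPartialHomeomorph M F}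
    (hφ : ContMDiffOn I 𝓘(ℝ, F) ∞ φ φ.source) (hφs : ContMDiffOn 𝓘(ℝ, F) I ∞ φ.symm φ.target)
    {L : Submodule ℝ F} (hL : D ∩ φ.source = φ.source ∩ φ ⁻¹' (L : Set F))
    (htan : ∀ y ∈ D ∩ φ.source, mfderiv I 𝓘(ℝ, F) φ y (V y) ∈ L)
    {γ : ℝ → M} (hγ : IsMIntegralCurve γ V) {t₁ : ℝ} (h₁ : γ t₁ ∈ D) (h₁s : γ t₁ ∈ φ.source) :
    ∀ᶠ t in 𝓝 t₁, γ t ∈ D := by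
  have htop : (∞ : WithTop ℕ∞) ≠ 0 := by simp
  set x₁ := γ t₁ with hx₁
  set z₀ : F := φ x₁ with hz₀
  have hz₀t : z₀ ∈ φ.target := φ.map_source h₁s
  have hz₀L : z₀ ∈ L := by
    have h : x₁ ∈ D ∩ φ.source := ⟨h₁, h₁s⟩
    rw [hL] at h
    exact h.2
  -- the field read in the chart
  set W : F → F := fun z => mfderiv I 𝓘(ℝ, F) φ (φ.symm z) (V (φ.symm z)) with hW
  have hWeq : ∀ z ∈ φ.target, VectorField.mpullback 𝓘(ℝ, F) I φ.symm V z = W z := by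
    intro z hz
    rw [VectorField.mpullback_apply, (inverse_mfderiv_symm_eq htop hφ hφs hz).2]
    rfl
  -- `W` is `C¹` near `z₀`, hence Lipschitz on a ball
  have hWs : ContDiffAt ℝ 1 W z₀ := by
    have h1 : ContMDiffAt 𝓘(ℝ, F) 𝓘(ℝ, F).tangent 1
        (fun z => (⟨z, VectorField.mpullback 𝓘(ℝ, F) I φ.symm V z⟩ :
          TangentBundle 𝓘(ℝ, F) F)) z₀ :=
      ContMDiffAt.mpullback_vectorField_preimage (n := ∞) (hV (φ.symm z₀))
        (hφs.contMDiffAt (φ.open_target.mem_nhds hz₀t))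
        (inverse_mfderiv_symm_eq htop hφ hφs hz₀t).1 (by norm_cast)
    have h2 : ContDiffAt ℝ 1 (fun z => VectorField.mpullback 𝓘(ℝ, F) I φ.symm V z) z₀ :=
      contMDiffAt_vectorSpace_iff_contDiffAt.1 h1
    refine h2.congr_of_eventuallyEq ?_
    filter_upwards [φ.open_target.mem_nhds hz₀t] with z hz
    exact (hWeq z hz).symm
  obtain ⟨K, T, hT, hKW⟩ := hWs.exists_lipschitzOnWith
  obtain ⟨r, hr, hrT⟩ := Metric.mem_nhds_iff.1 (inter_mem hT (φ.open_target.mem_nhds hz₀t))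
  have hBT : ball z₀ r ⊆ T := fun z hz => (hrT hz).1
  have hBt : ball z₀ r ⊆ φ.target := fun z hz => (hrT hz).2
  have hWB : LipschitzOnWith K W (ball z₀ r) := hKW.mono hBT
  -- tangency of `W` along `L`
  have hWtan : ∀ z ∈ ball z₀ r, z ∈ L → W z ∈ L := by
    intro z hz hzL
    have h1 : φ.symm z ∈ D ∩ φ.source := by
      rw [hL]
      exact ⟨φ.map_target (hBt hz), by rw [mem_preimage, φ.right_inv (hBt hz)]; exact hzL⟩
    exact htan _ h1
  -- a projection with kernel `L`, and a smaller ball whose points project into the ball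
  obtain ⟨P, hP, hP'⟩ := exists_continuousLinearMap_ker_eq L
  set r' : ℝ := r / (1 + ‖P‖) with hr'
  have h1P : 0 < 1 + ‖P‖ := by positivity
  have hr'pos : 0 < r' := div_pos hr h1P
  have hproj : ∀ z ∈ ball z₀ r', z - P z ∈ ball z₀ r := by
    intro z hz
    rw [mem_ball, dist_eq_norm] at hz ⊢
    have hPz : P z = P (z - z₀) := by
      rw [map_sub, (hP z₀).2 hz₀L, sub_zero]
    calc ‖z - P z - z₀‖ = ‖(z - z₀) - P (z - z₀)‖ := by rw [hPz]; abel_nf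
      _ ≤ ‖z - z₀‖ + ‖P (z - z₀)‖ := norm_sub_le _ _
      _ ≤ ‖z - z₀‖ + ‖P‖ * ‖z - z₀‖ := by gcongr; exact P.le_opNorm _
      _ = (1 + ‖P‖) * ‖z - z₀‖ := by ring
      _ < (1 + ‖P‖) * r' := by gcongr
      _ = r := by rw [hr']; field_simp
  have hB'B : ball z₀ r' ⊆ ball z₀ r :=
    ball_subset_ball (div_le_self hr.le (le_add_of_nonneg_right (norm_nonneg P)))
  -- the curve read in the chart, on a time interval where it stays in the small ball
  set c : ℝ → F := fun t => φ (γ t) with hc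
  have hγc : Continuous γ := hγ.continuous
  have hJ : ∀ᶠ t in 𝓝 t₁, γ t ∈ φ.source ∧ c t ∈ ball z₀ r' := by
    have hJ1 : ∀ᶠ t in 𝓝 t₁, γ t ∈ φ.source :=
      hγc.continuousAt.preimage_mem_nhds (φ.open_source.mem_nhds h₁s)
    have hcc : ContinuousAt c t₁ :=
      (φ.continuousAt h₁s).comp hγc.continuousAt
    have hJ2 : ∀ᶠ t in 𝓝 t₁, c t ∈ ball z₀ r' :=
      hcc.preimage_mem_nhds (isOpen_ball.mem_nhds (by rw [hc]; exact mem_ball_self hr'pos))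
    exact hJ1.and hJ2
  obtain ⟨ε, hε, hεJ⟩ := Metric.eventually_nhds_iff_ball.1 hJ
  -- the chain rule along the curve
  have hVcongr : ∀ a b : M, a = b →
      mfderiv I 𝓘(ℝ, F) φ a (V a) = mfderiv I 𝓘(ℝ, F) φ b (V b) := by
    rintro a b rfl
    rfl
  have hderiv : ∀ t, γ t ∈ φ.source → HasDerivAt c (W (c t)) t := by
    intro t ht
    have h1 : HasMFDerivAt 𝓘(ℝ, ℝ) I γ t ((1 : ℝ →L[ℝ] ℝ).smulRight (V (γ t))) := hγ t
    have h2 : HasMFDerivAt I 𝓘(ℝ, F) φ (γ t) (mfderiv I 𝓘(ℝ, F) φ (γ t)) :=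
      ((hφ.mdifferentiableOn htop (γ t) ht).mdifferentiableAt
        (φ.open_source.mem_nhds ht)).hasMFDerivAt
    have h3 := h2.comp t h1
    rw [hasMFDerivAt_iff_hasFDerivAt] at h3
    have h4 := h3.hasDerivAt
    have h5 : ((mfderiv I 𝓘(ℝ, F) φ (γ t)).comp ((1 : ℝ →L[ℝ] ℝ).smulRight (V (γ t)))) (1 : ℝ)
        = W (c t) := by
      rw [ContinuousLinearMap.comp_apply, ContinuousLinearMap.smulRight_apply,
        one_apply_eq_self, one_smul]
      exact hVcongr _ _ (φ.left_inv ht).symm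
    exact h4.congr_deriv h5
  -- conclusion on the interval `(t₁ - ε, t₁ + ε)`
  refine Metric.eventually_nhds_iff_ball.2 ⟨ε, hε, fun t ht => ?_⟩
  have hmemL : c t ∈ L := by
    rcases le_total t₁ t with hle | hle
    · -- forward in time on `[t₁, t]`
      have hsub : Icc t₁ t ⊆ ball t₁ ε := fun s hs => by
        rw [mem_ball, Real.dist_eq, abs_lt] at ht ⊢
        constructor <;> linarith [hs.1, hs.2, ht.1, ht.2]
      exact mem_submodule_of_hasDerivAt_of_lipschitzOnWith hWB hWtan hP hP'
        (fun s hs => hderiv s (hεJ s (hsub hs)).1)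
        (fun s hs => hB'B (hεJ s (hsub hs)).2) (fun s hs => hproj _ (hεJ s (hsub hs)).2)
        (by rw [hc]; exact hz₀L) t (right_mem_Icc.2 hle)
    · -- backward in time on `[t, t₁]`
      have hsub : Icc t t₁ ⊆ ball t₁ ε := fun s hs => by
        rw [mem_ball, Real.dist_eq, abs_lt] at ht ⊢
        constructor <;> linarith [hs.1, hs.2, ht.1, ht.2]
      exact mem_submodule_of_hasDerivAt_of_lipschitzOnWith_of_right hWB hWtan hP hP'
        (fun s hs => hderiv s (hεJ s (hsub hs)).1)
        (fun s hs => hB'B (hεJ s (hsub hs)).2) (fun s hs => hproj _ (hεJ s (hsub hs)).2)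
        (by rw [hc]; exact hz₀L) t (left_mem_Icc.2 hle)
  have hfin : γ t ∈ D ∩ φ.source := by
    rw [hL]
    exact ⟨(hεJ t ht).1, hmemL⟩
  exact hfin.1

/-- **Integral curves of a `C¹` field tangent to a straightened closed set cannot leave or enter
it** (the invariance behind the relative form of Ehresmann's theorem, Dimca 1992 Ch. 1
Prop. (3.1); for finitely many submanifolds crossing normally, Thom's first isotopy lemma in its
simplest instance, Dimca 1992 Ch. 1 Thm. (3.5)). Let `V` be a `C¹` vector field on a `C^∞` manifold
`M` (complete model) and `D ⊆ M` closed such that every point of `D` lies in the source of an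
open partial homeomorphism `φ : M ⇀ F` (`F` finite-dimensional), `C^∞` with `C^∞` inverse, with
`D ∩ source φ = φ⁻¹(L)` for a linear subspace `L ⊆ F` and `dφ(V y) ∈ L` for `y ∈ D ∩ source φ`.
Then an integral curve `γ : ℝ → M` of `V` which lies in `D` at some time lies in `D` at all times
(the set of such times is closed, and open by `eventually_mem_of_isMIntegralCurve_of_tangent`).
[cite: Dimca1992, Ch. 1 Prop. (3.1) and Thm. (3.5)] -/
theorem mem_of_isMIntegralCurve_of_tangent [CompleteSpace E] [IsManifold I ∞ M]
    [FiniteDimensional ℝ F] {V : Π x : M, TangentSpace I x}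
    (hV : ContMDiff I I.tangent 1 (fun x => (⟨x, V x⟩ : TangentBundle I M)))
    {D : Set M} (hD : IsClosed D)
    (hchart : ∀ x ∈ D, ∃ (φ : OpenPartialHomeomorph M F) (L : Submodule ℝ F), x ∈ φ.source ∧
      ContMDiffOn I 𝓘(ℝ, F) ∞ φ φ.source ∧ ContMDiffOn 𝓘(ℝ, F) I ∞ φ.symm φ.target ∧
      D ∩ φ.source = φ.source ∩ φ ⁻¹' (L : Set F) ∧
      ∀ y ∈ D ∩ φ.source, mfderiv I 𝓘(ℝ, F) φ y (V y) ∈ L)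
    {γ : ℝ → M} (hγ : IsMIntegralCurve γ V) {t₀ : ℝ} (h₀ : γ t₀ ∈ D) (t : ℝ) : γ t ∈ D := by
  set S : Set ℝ := {t | γ t ∈ D} with hS
  have hSc : IsClosed S := hD.preimage hγ.continuous
  have hSo : IsOpen S := by
    refine isOpen_iff_mem_nhds.2 fun t₁ ht₁ => ?_
    obtain ⟨φ, L, hx, hφ, hφs, hL, htan⟩ := hchart (γ t₁) ht₁
    exact eventually_mem_of_isMIntegralCurve_of_tangent hV hφ hφs hL htan hγ ht₁ hx
  have hclopen : IsClopen S := ⟨hSc, hSo⟩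
  rcases isClopen_iff.1 hclopen with h | h
  · exact absurd h₀ (by rw [← mem_setOf_eq (p := fun t => γ t ∈ D), ← hS, h]; exact notMem_empty _)
  · have : t ∈ S := by rw [h]; exact mem_univ t
    exact this

/-- In the situation of `mem_of_isMIntegralCurve_of_tangent`, an integral curve which is off `D` at
some time is off `D` at all times. [cite: Dimca1992, Ch. 1 Prop. (3.1) and Thm. (3.5)] -/
theorem notMem_of_isMIntegralCurve_of_tangent [CompleteSpace E] [IsManifold I ∞ M]
    [FiniteDimensional ℝ F] {V : Π x : M, TangentSpace I x}
    (hV : ContMDiff I I.tangent 1 (fun x => (⟨x, V x⟩ : TangentBundle I M)))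
    {D : Set M} (hD : IsClosed D)
    (hchart : ∀ x ∈ D, ∃ (φ : OpenPartialHomeomorph M F) (L : Submodule ℝ F), x ∈ φ.source ∧
      ContMDiffOn I 𝓘(ℝ, F) ∞ φ φ.source ∧ ContMDiffOn 𝓘(ℝ, F) I ∞ φ.symm φ.target ∧
      D ∩ φ.source = φ.source ∩ φ ⁻¹' (L : Set F) ∧
      ∀ y ∈ D ∩ φ.source, mfderiv I 𝓘(ℝ, F) φ y (V y) ∈ L)
    {γ : ℝ → M} (hγ : IsMIntegralCurve γ V) {t₀ : ℝ} (h₀ : γ t₀ ∉ D) (t : ℝ) : γ t ∉ D :=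
  fun ht => h₀ (mem_of_isMIntegralCurve_of_tangent hV hD hchart hγ ht t₀)

/-- **Membership in a straightened closed set is constant along integral curves** of a `C¹` field
tangent to it (combination of the two previous statements). [cite: Dimca1992, Ch. 1 Prop. (3.1) and Thm. (3.5)] -/
theorem mem_iff_mem_of_isMIntegralCurve_of_tangent [CompleteSpace E] [IsManifold I ∞ M]
    [FiniteDimensional ℝ F] {V : Π x : M, TangentSpace I x}
    (hV : ContMDiff I I.tangent 1 (fun x => (⟨x, V x⟩ : TangentBundle I M)))
    {D : Set M} (hD : IsClosed D)
    (hchart : ∀ x ∈ D, ∃ (φ : OpenPartialHomeomorph M F) (L : Submodule ℝ F), x ∈ φ.source ∧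
      ContMDiffOn I 𝓘(ℝ, F) ∞ φ φ.source ∧ ContMDiffOn 𝓘(ℝ, F) I ∞ φ.symm φ.target ∧
      D ∩ φ.source = φ.source ∩ φ ⁻¹' (L : Set F) ∧
      ∀ y ∈ D ∩ φ.source, mfderiv I 𝓘(ℝ, F) φ y (V y) ∈ L)
    {γ : ℝ → M} (hγ : IsMIntegralCurve γ V) (s t : ℝ) : γ s ∈ D ↔ γ t ∈ D :=
  ⟨fun h => mem_of_isMIntegralCurve_of_tangent hV hD hchart hγ h t,
    fun h => mem_of_isMIntegralCurve_of_tangent hV hD hchart hγ h s⟩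

end Manifold

end Literature.Geometry.Manifold
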